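import Summits.Ventures.HodgeRepro2.T4GroupData

/-!
# T4Parity — Lemma B1.2.5 as a PARITY statement in the `LocalSymbols` model (sub-claim B1)

Cell pub-hodge-repro2, Tier 4, sub-claim B1 (route/T4-B1-p3.md, owner p3). T4GroupData.lean records Lemma B1.2.5
in the model `LocalSymbols ι G` (local characters `χ_v : G_v →* ℤˣ`, the symbol product `∏ᶠ_v χ_v(d_v)`, the norm
subgroup `∏ ker χ_v`, a principal subgroup `P` with the product formula and index 2 as hypotheses) in the form
`symbolProd d = −1 ⟺ d ∉ P ⊔ N`. The prose states the same lemma as «V′ is incoherent ⟺ |T(V′)| is odd», with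
`T(V′) = {v : D_v is not a local norm at v}`. This file supplies the missing bookkeeping:

* `symbolProd_eq_neg_one_pow_ncard`: `∏ᶠ_v χ_v(d_v) = (−1)^{|T(d)|}` where `T(d) := {v : χ_v(d_v) = −1}` is the
  (finite) set of places where `d_v` is not a local norm — the prose's «φ(D) = (−1)^{|T(V′)|}»;
* `symbolProd_eq_neg_one_iff_odd_ncard`: `symbolProd d = −1 ⟺ |T(d)| odd`;
* `not_mem_sup_iff_odd_ncard`: under the two printed hypotheses (O'Meara 71:18 = product formula on `P`;
  O'Meara 65:21 = index 2) and the existence of one idèle of symbol `−1`: `d ∉ P ⊔ N ⟺ |T(d)| odd` —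
  Lemma B1.2.5 verbatim (Liu Def. C.3 ⟺ Gross §4's «odd number of places where `d_v` is not a norm»).

Imports the cell's own T4GroupData.lean (p388359) and Mathlib; nothing else.
-/

namespace Summit.Ventures.HodgeRepro2.T4GroupData.LocalSymbols

variable {ι : Type*} {G : ι → Type*} [∀ v, CommGroup (G v)]

/-- The set `T(d)` of places where the local symbol of `d` is `−1` («`d_v` is not a local norm at `v`», O'Meara's
(N2)); for a hermitian determinant `D` this is the prose's `T(V′)`. -/
def nonNormSet (S : LocalSymbols ι G) (d : ∀ v, G v) : Set ι :=
  {v | S.χ v (d v) = -1}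

/-- A unit of `ℤ` is `−1` iff it is not `1` (kept in this namespace, not in Mathlib's `Int`). -/
theorem intUnits_eq_neg_one_iff_ne_one (u : ℤˣ) : u = -1 ↔ u ≠ 1 := by
  rcases Int.units_eq_one_or u with rfl | rfl <;> decide

/-- The multiplicative support of `v ↦ χ_v(d_v)` is exactly `T(d)`. -/
theorem mulSupport_eq_nonNormSet (S : LocalSymbols ι G) (d : ∀ v, G v) :
    Function.mulSupport (fun v => S.χ v (d v)) = S.nonNormSet d := by
  ext v
  simp only [Function.mem_mulSupport, nonNormSet, Set.mem_setOf_eq]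
  exact (intUnits_eq_neg_one_iff_ne_one _).symm

/-- `T(d)` is finite exactly when the symbols of `d` have finite support (the standing hypothesis of the model,
met for every idèle: O'Meara 63:12 at almost all places). -/
theorem nonNormSet_finite_iff (S : LocalSymbols ι G) (d : ∀ v, G v) :
    (S.nonNormSet d).Finite ↔ Function.HasFiniteMulSupport fun v => S.χ v (d v) := by
  rw [Function.HasFiniteMulSupport, mulSupport_eq_nonNormSet]

/-- Lemma B1.2.5, the count: `φ(D) = ∏_v (D_v, θ)_v = (−1)^{|T(V′)|}` — in the model, the symbol product of `d`
with finite symbol support equals `(−1)^{|T(d)|}`. -/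
theorem symbolProd_eq_neg_one_pow_ncard (S : LocalSymbols ι G) (d : ∀ v, G v)
    (hd : Function.HasFiniteMulSupport fun v => S.χ v (d v)) :
    S.symbolProd d = (-1) ^ (S.nonNormSet d).ncard := by
  have hfin : (S.nonNormSet d).Finite := (nonNormSet_finite_iff S d).mpr hd
  unfold symbolProd
  rw [finprod_eq_prod_of_mulSupport_subset (s := hfin.toFinset)]
  · rw [Set.ncard_eq_toFinset_card _ hfin]
    refine Finset.prod_eq_pow_card ?_
    intro v hv
    exact hfin.mem_toFinset.mp hv
  · rw [mulSupport_eq_nonNormSet]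
    exact fun v hv => hfin.mem_toFinset.mpr hv

/-- `(−1)^n = −1` in `ℤˣ` iff `n` is odd (Mathlib's `neg_one_pow_eq_neg_one_iff_odd` specialised to `ℤˣ`). -/
theorem intUnits_neg_one_pow_eq_neg_one_iff (n : ℕ) : ((-1 : ℤˣ) ^ n = -1) ↔ Odd n :=
  neg_one_pow_eq_neg_one_iff_odd (by decide)

/-- Lemma B1.2.5 as parity: the symbol product of `d` is `−1` iff `|T(d)|` is odd. -/
theorem symbolProd_eq_neg_one_iff_odd_ncard (S : LocalSymbols ι G) (d : ∀ v, G v)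
    (hd : Function.HasFiniteMulSupport fun v => S.χ v (d v)) :
    S.symbolProd d = -1 ↔ Odd (S.nonNormSet d).ncard := by
  rw [symbolProd_eq_neg_one_pow_ncard S d hd]
  exact intUnits_neg_one_pow_eq_neg_one_iff _

/-- Lemma B1.2.5 verbatim in the model (Liu Def. C.3 ⟺ Gross §4): with the product formula on the principal
subgroup `P` (O'Meara 71:18), finite symbol support on `P`, index `(P ⊔ N : …) = 2` (O'Meara 65:21) and one idèle
`j` of symbol `−1` with finite support (the idèle `j = (−1 at τ₀)` of the prose, whose real symbol is computed in
T4RealPlace.lean), an element `d` with finite symbol support lies OUTSIDE `P ⊔ N` — «the determinant belongs to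
`A_F^× ∖ F^× N(A_E^×)`», i.e. the space is incoherent — iff `|T(d)|` is odd. -/
theorem not_mem_sup_iff_odd_ncard (S : LocalSymbols ι G) (P : Subgroup (∀ v, G v))
    (hP : ∀ f ∈ P, S.symbolProd f = 1)
    (hPfin : ∀ f ∈ P, Function.HasFiniteMulSupport fun v => S.χ v (f v))
    (hidx : (P ⊔ S.normSubgroup).index = 2)
    (j : ∀ v, G v) (hj : S.symbolProd j = -1)
    (hjfin : Function.HasFiniteMulSupport fun v => S.χ v (j v))
    (d : ∀ v, G v) (hd : Function.HasFiniteMulSupport fun v => S.χ v (d v)) :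
    d ∉ P ⊔ S.normSubgroup ↔ Odd (S.nonNormSet d).ncard := by
  rw [← symbolProd_eq_neg_one_iff_not_mem S P hP hPfin hidx j hj hjfin d]
  exact symbolProd_eq_neg_one_iff_odd_ncard S d hd

/-- The explicit space of B1.2: the idèle `a = mulSingle v₀ a₀` with `χ_{v₀}(a₀) = −1` has `T(a) = {v₀}`, of
cardinality 1 (odd) — the prose's «for our V, T(V) = {v₀}». -/
theorem nonNormSet_mulSingle [DecidableEq ι] (S : LocalSymbols ι G) (v₀ : ι) (a₀ : G v₀)
    (ha₀ : S.χ v₀ a₀ = -1) : S.nonNormSet (Pi.mulSingle v₀ a₀) = {v₀} := by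
  ext v
  simp only [nonNormSet, Set.mem_setOf_eq, Set.mem_singleton_iff]
  by_cases hv : v = v₀
  · subst hv
    simp [ha₀]
  · rw [Pi.mulSingle_eq_of_ne hv, map_one]
    exact iff_of_false (by decide) hv

/-- `|T(a)| = 1` for the explicit idèle of B1.2: an odd number, as Lemma B1.2.4 requires. -/
theorem ncard_nonNormSet_mulSingle [DecidableEq ι] (S : LocalSymbols ι G) (v₀ : ι) (a₀ : G v₀)
    (ha₀ : S.χ v₀ a₀ = -1) : (S.nonNormSet (Pi.mulSingle v₀ a₀)).ncard = 1 := by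
  rw [nonNormSet_mulSingle S v₀ a₀ ha₀, Set.ncard_singleton]

end Summit.Ventures.HodgeRepro2.T4GroupData.LocalSymbols
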